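import Summits.ValiantsHypothesis.ValiantsHypothesis.Theorems.GrenetZeonDualUnipotentThreeHalvesHeavyTopInvariantFlag
import Literature.LinearAlgebra.Matrix.NilpotentSumTraceOrthogonality
import Literature.LinearAlgebra.Matrix.FlandersTheorem
import Summits.ValiantsHypothesis.ValiantsHypothesis.Theorems.GrenetZeonDualUnipotentThreeHalvesRadicalCoarsening
import Summits.ValiantsHypothesis.ValiantsHypothesis.Theorems.GrenetZeonDualUnipotentThreeHalvesRadicalCoarseningFineFlag
import Summits.ValiantsHypothesis.ValiantsHypothesis.Theorems.DualUnipotentThreeHalves.Negative.HeavyTopInstFourSeven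

/-!
# Sketch — val-idea-26 g0 (lens a: Gerstenhaber-type nilpotent-subspace structure theory)
# crux `GrenetZeon.DualUnipotentThreeHalves` (stmt-ValiantsHypothesis-24318), residue R2 `HeavyTopLaw`

First-lemma signatures for the crux idea card «krylov-seed» (uniform weight flags from Krylov seeds /
low-orbit vectors of the nilpotent space `W = ℂ·N₀ + 𝒯`).  Nothing here is asserted as true beyond what is
proved below; `HeavyTopLaw`, 24318, S3b, 8062 and `VP ≠ VNP` are NOT proved.
-/

set_option linter.dupNamespace false

noncomputable section

namespace Summit.ValiantsHypothesis.ValiantsHypothesis.Cruxes.DualUnipotentThreeHalves.KrylovSeed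

open MvPolynomial Matrix
open Summit.ValiantsHypothesis.ValiantsHypothesis.Cruxes.TwoDimCoefficients.DimTwoCases (AffMat IsAffine)
open Summit.ValiantsHypothesis.ValiantsHypothesis.Theorems.GrenetZeon.RadicalSplit
open Summit.ValiantsHypothesis.ValiantsHypothesis.Theorems.GrenetZeon.HeavyTopInvariantFlag
  (flagCheap_of_weight_levels)
open Summit.ValiantsHypothesis.ValiantsHypothesis.Theorems.GrenetZeon.RadicalCoarsening
  (exists_adapted_basis conj_entry_eq_repr toMatrix'_equivFun_mul_symm toMatrix'_symm_mul_equivFun)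

variable {m : ℕ}

/-! ## §1 Uniform weight-flag certificates («weight-thin» pencils) — the restricted sub-case, PROVED -/

/-- A pencil is **weight-thin** if ONE constant weight flag (change of basis `P`, levels `lvl < p`, drop `r`,
climb `c ≥ 1`) and ONE direction space `K` certify it: the whole pencil lowers levels by at most `r`, the tops
`N_lin(v)`, `v ∈ K`, raise levels by at least `c`, and `(⌊(p-1+r(n-1))/(c+r)⌋ + 1)·n < dim K`.
`r = 0, c = 1` = invariant flags (Theorem G / G′); `p = 3, r = c = 1` = the Hessenberg «one-level-return» flag. -/
def WeightThin (n m : ℕ) (N : AffMat n m) : Prop :=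
  ∃ (P : (Matrix (Fin m) (Fin m) ℂ)ˣ) (lvl : Fin m → ℕ) (p r c : ℕ) (K : Submodule ℂ (Fin n × Fin n → ℂ)),
    1 ≤ c ∧ (∀ i, lvl i < p) ∧
    (∀ i j : Fin m, lvl i + r < lvl j →
      ((P : Matrix (Fin m) (Fin m) ℂ).map C * N * (↑P⁻¹ : Matrix (Fin m) (Fin m) ℂ).map C :
        Matrix (Fin m) (Fin m) (MvPolynomial (Fin n × Fin n) ℂ)) i j = 0) ∧
    (∀ v ∈ K, ∀ i j : Fin m, lvl i < lvl j + c →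
      ((P : Matrix (Fin m) (Fin m) ℂ) * linPart N v * (↑P⁻¹ : Matrix (Fin m) (Fin m) ℂ)) i j = 0) ∧
    ((p - 1 + r * (n - 1)) / (c + r) + 1) * n < Module.finrank ℂ K

/-- **Restricted sub-case (PROVED): weight-thin affine pencils are flag-cheap.**  Immediate from the tree's
✓ `flagCheap_of_weight_levels` (Theorem G″). -/
theorem flagCheap_of_weightThin {n : ℕ} (N : AffMat n m) (hN : IsAffine N) (h : WeightThin n m N) :
    FlagCheap n m N := by
  obtain ⟨P, lvl, p, r, c, K, hc, hlvl, hdrop, hK, hdim⟩ := h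
  exact flagCheap_of_weight_levels N hN P lvl p r c hc hlvl hdrop K hK _ le_rfl hdim

/-- **The transferred crux C⁺ («uniform weight law»)**: in the regime `C₀ m² < n³`, every top-heavy affine nilpotent
pencil is weight-thin.  STRONGER than `HeavyTopLaw` (one constant flag for all lines instead of line-dependent
flags); a statement about the nilpotent linear space `W = ℂ N₀ + 𝒯` alone.  OPEN; never asserted. -/
def UniformWeightLaw : Prop :=
  ∃ C₀ n₀ : ℕ, ∀ n ≥ n₀, ∀ m : ℕ, C₀ * m ^ 2 < n ^ 3 → ∀ N : AffMat n m, IsAffine N → N ^ m = 0 →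
    (∀ K : Submodule ℂ (Fin n × Fin n → ℂ), RadOrth n m N K →
      Module.finrank ℂ K ≤ 16 * m * Nat.sqrt n + 16 * n) →
    WeightThin n m N

/-- **Transfer (PROVED): `UniformWeightLaw → HeavyTopLaw`** (R2), fact-free. -/
theorem heavyTopLaw_of_uniformWeightLaw (h : UniformWeightLaw) : HeavyTopLaw := by
  obtain ⟨C₀, n₀, hlaw⟩ := h
  refine ⟨C₀, n₀, fun n hn m hreg N hN hnil htop => ?_⟩
  exact flagCheap_of_weightThin N hN (hlaw n hn m hreg N hN hnil htop)

/-! ## §2 Krylov flags: every space of matrices is HESSENBERG for the Krylov flag of any seed (PROVED) -/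

/-- The span of the orbits `W • F = span{A v : A ∈ W, v ∈ F}`. -/
def orbitSpan (W : Submodule ℂ (Matrix (Fin m) (Fin m) ℂ)) (F : Submodule ℂ (Fin m → ℂ)) :
    Submodule ℂ (Fin m → ℂ) :=
  Submodule.span ℂ {y | ∃ A ∈ W, ∃ v ∈ F, y = A *ᵥ v}

/-- The Krylov flag of a seed `S`: `F₀ = 0`, `F_{t+1} = S + F_t + W • F_t`. -/
def krylov (W : Submodule ℂ (Matrix (Fin m) (Fin m) ℂ)) (S : Submodule ℂ (Fin m → ℂ)) :
    ℕ → Submodule ℂ (Fin m → ℂ)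
  | 0 => ⊥
  | t + 1 => (S ⊔ krylov W S t) ⊔ orbitSpan W (krylov W S t)

/-- **Hessenberg property (PROVED)**: every `A ∈ W` maps `F_t` into `F_{t+1}` — the Krylov flag of ANY seed is a
weight flag with drop `r = 1` for the whole space `W` (no invariance needed; irreducible `W` allowed). -/
theorem krylov_hessenberg (W : Submodule ℂ (Matrix (Fin m) (Fin m) ℂ)) (S : Submodule ℂ (Fin m → ℂ))
    {A : Matrix (Fin m) (Fin m) ℂ} (hA : A ∈ W) (t : ℕ) {v : Fin m → ℂ} (hv : v ∈ krylov W S t) :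
    A *ᵥ v ∈ krylov W S (t + 1) := by
  change A *ᵥ v ∈ (S ⊔ krylov W S t) ⊔ orbitSpan W (krylov W S t)
  exact Submodule.mem_sup_right (Submodule.subset_span ⟨A, hA, v, hv, rfl⟩)

/-- The Krylov flag is monotone: `F_t ≤ F_{t+1}`. -/
theorem krylov_le_succ (W : Submodule ℂ (Matrix (Fin m) (Fin m) ℂ)) (S : Submodule ℂ (Fin m → ℂ)) (t : ℕ) :
    krylov W S t ≤ krylov W S (t + 1) := by
  change krylov W S t ≤ (S ⊔ krylov W S t) ⊔ orbitSpan W (krylov W S t)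
  exact le_sup_of_le_left le_sup_right

/-- The **orbit dimension** of a vector, `dim (W • x)` (= the rank of `x̂ : A ↦ A x` in de Seguins Pazzis' dual
bounded-rank space `ℳ_W`), and the new invariant `σ(W)` = the least orbit dimension of a non-zero vector. -/
def orbitDim (W : Submodule ℂ (Matrix (Fin m) (Fin m) ℂ)) (x : Fin m → ℂ) : ℕ :=
  Module.finrank ℂ (orbitSpan W (Submodule.span ℂ {x}))

/-- `σ(W) = min_{x ≠ 0} dim (W • x)` (`0` for `m = 0` by the junk value of `sInf ∅`). -/
def minOrbit (W : Submodule ℂ (Matrix (Fin m) (Fin m) ℂ)) : ℕ :=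
  sInf {t | ∃ x : Fin m → ℂ, x ≠ 0 ∧ orbitDim W x = t}

/-! ## §3 First lemmas of the line (signatures; to be proved by the line, not here) -/

/-- **First lemma A (Flanders–Dieudonné–Meshulam kernel→image lemma)**: in a linear space of matrices, an element
`A` of MAXIMAL rank satisfies `B (ker A) ⊆ Im A` for every `B` in the space.  Applied to the nilpotent space
`W = ℂ N₀ + 𝒯` it gives the CANONICAL 3-level Hessenberg flag `ker A ⊂ ker A + Im A ⊂ ℂ^m` of the generic
element and the canonical seed `S = ker A`. [standard: Flanders 1962; Meshulam 1985 Lemma 1; dSP 2013 QJM §2] -/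
theorem mulVec_mem_range_of_rank_max (W : Submodule ℂ (Matrix (Fin m) (Fin m) ℂ))
    {A B : Matrix (Fin m) (Fin m) ℂ} (hA : A ∈ W) (hB : B ∈ W) (hmax : ∀ C' ∈ W, C'.rank ≤ A.rank)
    {x : Fin m → ℂ} (hx : A *ᵥ x = 0) :
    B *ᵥ x ∈ LinearMap.range (Matrix.mulVecLin A) := by
  -- transport to linear maps and apply the tree's Flanders–Dieudonné maximal-rank lemma
  -- `Literature.LinearAlgebra.Matrix.apply_mem_range_of_mem_ker` ("A₄ = 0").
  let Φ := (Matrix.toLin' : Matrix (Fin m) (Fin m) ℂ ≃ₗ[ℂ] ((Fin m → ℂ) →ₗ[ℂ] (Fin m → ℂ))).toLinearMap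
  let W' : Submodule ℂ ((Fin m → ℂ) →ₗ[ℂ] (Fin m → ℂ)) := W.map Φ
  have hmem : ∀ C ∈ W, C.mulVecLin ∈ W' := fun C hC =>
    ⟨C, hC, by simp [Φ, Matrix.toLin'_apply']⟩
  have hmax' : ∀ h ∈ W', Module.finrank ℂ (LinearMap.range h) ≤
      Module.finrank ℂ (LinearMap.range A.mulVecLin) := by
    rintro h ⟨C, hC, rfl⟩
    have h1 : Φ C = C.mulVecLin := by simp [Φ, Matrix.toLin'_apply']
    rw [h1]
    exact hmax C hC
  have hx' : A.mulVecLin x = 0 := by simpa using hx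
  have := Literature.LinearAlgebra.Matrix.apply_mem_range_of_mem_ker (hmem A hA) hmax' (hmem B hB) hx'
  simpa using this

/-- **First lemma B (Krylov certificate = the restricted sub-case in seed form) — PROVED**: if the Krylov flag of a seed `S`
under `W ⊇ {N(x)} ∪ {N_lin v}` exhausts `ℂ^m` in `p` steps and the tops whose action LIFTS the flag
(`N_lin(v) F_{t+1} ⊆ F_t`) form a direction space of dimension `> (⌊(p+n-2)/2⌋ + 1)·n`, the pencil is weight-thin
(hence flag-cheap).  [basis adapted to the chain; `r = c = 1` in `WeightThin`] -/
theorem weightThin_of_krylov {n : ℕ} (N : AffMat n m) (_hN : IsAffine N)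
    (W : Submodule ℂ (Matrix (Fin m) (Fin m) ℂ))
    (hW₀ : ∀ x : Fin n × Fin n → ℂ, N.map (MvPolynomial.eval x) ∈ W)
    (S : Submodule ℂ (Fin m → ℂ)) (p : ℕ) (htop : krylov W S p = ⊤)
    (K : Submodule ℂ (Fin n × Fin n → ℂ))
    (hK : ∀ v ∈ K, ∀ t, ∀ y ∈ krylov W S (t + 1), linPart N v *ᵥ y ∈ krylov W S t)
    (hdim : ((p - 1 + (n - 1)) / 2 + 1) * n < Module.finrank ℂ K) :
    WeightThin n m N := by
  classical
  -- the reversed (antitone) Krylov chain `G t = F_{p-t}`: `G 0 = ⊤`, `G p = ⊥`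
  have hmono : Monotone (krylov W S) := monotone_nat_of_le_succ (krylov_le_succ W S)
  let G : ℕ → Submodule ℂ (Fin m → ℂ) := fun t => krylov W S (p - t)
  have hanti : Antitone G := fun s t hst => hmono (Nat.sub_le_sub_left hst p)
  have hG0 : G 0 = ⊤ := by simpa [G] using htop
  have hGp : G p = ⊥ := by
    show krylov W S (p - p) = ⊥
    rw [Nat.sub_self]; rfl
  obtain ⟨b, lvl, hbmem, hlvl, key, -⟩ := exists_adapted_basis G hanti hG0 hGp
  -- the coordinate change
  let Pm : Matrix (Fin m) (Fin m) ℂ := LinearMap.toMatrix' (b.equivFun : (Fin m → ℂ) →ₗ[ℂ] (Fin m → ℂ))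
  let Qm : Matrix (Fin m) (Fin m) ℂ := LinearMap.toMatrix' (b.equivFun.symm : (Fin m → ℂ) →ₗ[ℂ] (Fin m → ℂ))
  let P : (Matrix (Fin m) (Fin m) ℂ)ˣ :=
    ⟨Pm, Qm, toMatrix'_equivFun_mul_symm b, toMatrix'_symm_mul_equivFun b⟩
  have hentry : ∀ (A : Matrix (Fin m) (Fin m) ℂ) (i j : Fin m), (Pm * A * Qm) i j = b.repr (A *ᵥ b j) i :=
    fun A i j => conj_entry_eq_repr b A i j
  refine ⟨P, lvl, p, 1, 1, K, le_rfl, hlvl, ?_, ?_, ?_⟩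
  · -- drop `r = 1`: every `N(x) ∈ W` maps `F_t` into `F_{t+1}` (Hessenberg property of the Krylov flag)
    intro i j hij
    show ((Pm.map C * N * Qm.map C : Matrix (Fin m) (Fin m) (MvPolynomial (Fin n × Fin n) ℂ)) i j) = 0
    apply MvPolynomial.funext
    intro x
    rw [map_zero]
    have hev : eval x ((Pm.map C * N * Qm.map C : Matrix (Fin m) (Fin m) (MvPolynomial (Fin n × Fin n) ℂ)) i j) =
        (Pm * N.map (eval x) * Qm) i j := by
      have h1 : ((Pm.map C * N * Qm.map C : Matrix (Fin m) (Fin m) (MvPolynomial (Fin n × Fin n) ℂ)).map (eval x)) =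
          Pm * N.map (eval x) * Qm := by
        rw [Matrix.map_mul, Matrix.map_mul, Matrix.map_map, Matrix.map_map]
        have hc : (⇑(eval x) ∘ (C : ℂ → MvPolynomial (Fin n × Fin n) ℂ)) = id := by
          funext a; simp
        rw [hc, Matrix.map_id, Matrix.map_id]
      have := congrFun (congrFun h1 i) j
      simpa [Matrix.map_apply] using this
    rw [hev, hentry]
    by_contra hne
    have hb : b j ∈ krylov W S (p - lvl j) := hbmem j
    have hy : N.map (eval x) *ᵥ b j ∈ krylov W S (p - lvl j + 1) := krylov_hessenberg W S (hW₀ x) _ hb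
    have hidx : p - lvl j + 1 = p - (lvl j - 1) := by have := hlvl j; omega
    rw [hidx] at hy
    have := key (lvl j - 1) _ hy i hne
    omega
  · -- climb `c = 1`: the tops in `K` map `F_{t+1}` into `F_t`
    intro v hv i j hij
    show (Pm * linPart N v * Qm) i j = 0
    rw [hentry]
    by_contra hne
    have hidx : p - lvl j = (p - lvl j - 1) + 1 := by have := hlvl j; omega
    have hb : b j ∈ krylov W S ((p - lvl j - 1) + 1) := hidx ▸ hbmem j
    have hy : linPart N v *ᵥ b j ∈ krylov W S (p - lvl j - 1) := hK v hv _ _ hb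
    have hidx' : p - lvl j - 1 = p - (lvl j + 1) := by omega
    rw [hidx'] at hy
    have := key (lvl j + 1) _ hy i hne
    omega
  · simpa using hdim

/-- Trace of a product against a matrix supported on the «glue» positions `(i ∉ I, j ∈ I)` is the sum over
those positions only. -/
theorem trace_mul_eq_sum_glue (I : Finset (Fin m)) (A B : Matrix (Fin m) (Fin m) ℂ)
    (hA : ∀ i j, (i ∈ I ∨ j ∉ I) → A i j = 0) :
    (A * B).trace = ∑ q : {q : Fin m × Fin m // q.1 ∉ I ∧ q.2 ∈ I}, A q.1.1 q.1.2 * B q.1.2 q.1.1 := by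
  classical
  have h1 : (A * B).trace = ∑ q : Fin m × Fin m, A q.1 q.2 * B q.2 q.1 := by
    simp only [Matrix.trace, Matrix.diag_apply, Matrix.mul_apply]
    rw [← Fintype.sum_prod_type']
  have h2 : ∑ q ∈ Finset.univ.filter (fun q : Fin m × Fin m => q.1 ∉ I ∧ q.2 ∈ I), A q.1 q.2 * B q.2 q.1
      = ∑ q : {q : Fin m × Fin m // q.1 ∉ I ∧ q.2 ∈ I}, A q.1.1 q.1.2 * B q.1.2 q.1.1 :=
    Finset.sum_subtype _ (fun q => by simp) (fun q : Fin m × Fin m => A q.1 q.2 * B q.2 q.1)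
  have h3 : ∑ q ∈ Finset.univ.filter (fun q : Fin m × Fin m => q.1 ∉ I ∧ q.2 ∈ I), A q.1 q.2 * B q.2 q.1
      = ∑ q : Fin m × Fin m, A q.1 q.2 * B q.2 q.1 := by
    apply Finset.sum_filter_of_ne
    intro q _ hq
    by_contra hnot
    apply hq
    have : q.1 ∈ I ∨ q.2 ∉ I := by
      by_cases h : q.1 ∈ I
      · exact Or.inl h
      · exact Or.inr fun h2 => hnot ⟨h, h2⟩
    rw [hA q.1 q.2 this, zero_mul]
  rw [h1, ← h3, h2]

/-- **First lemma C (glue–lift pairing, graded case) — PROVED.**  Trace isotropy `tr(AB) = 0` on a nilpotent space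
(✓ `Literature…trace_mul_eq_zero_of_mem`) pairs the GLUE block (rows outside `I`, columns in `I`: maps `U_I → U_{Iᶜ}`) with the
LIFT block (rows in `I`, columns outside `I`: maps `U_{Iᶜ} → U_I`) under the perfect pairing `(A, L) ↦ tr(AL)`; hence sub-spaces of a
nilpotent space supported on the two blocks have `dim G + dim L ≤ |I|·(m − |I|)`: FAT GLUE FORCES THIN LIFT.  (The version with block
PROJECTIONS of a non-graded space is false: `span{E₂₁+E₁₃, E₃₁−E₁₂} ⊂ M₃`.) -/
theorem glue_lift_pairing (W : Submodule ℂ (Matrix (Fin m) (Fin m) ℂ)) (hW : ∀ A ∈ W, IsNilpotent A)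
    (I : Finset (Fin m))
    (G L : Submodule ℂ (Matrix (Fin m) (Fin m) ℂ)) (hG : G ≤ W) (hL : L ≤ W)
    (hGsupp : ∀ A ∈ G, ∀ i j, (i ∈ I ∨ j ∉ I) → A i j = 0)   -- glue: rows outside `I`, columns in `I`
    (hLsupp : ∀ A ∈ L, ∀ i j, (i ∉ I ∨ j ∈ I) → A i j = 0) :  -- lift: rows in `I`, columns outside `I`
    Module.finrank ℂ G + Module.finrank ℂ L ≤ I.card * (m - I.card) := by
  classical
  -- glue positions and the two coordinate maps
  let P := {q : Fin m × Fin m // q.1 ∉ I ∧ q.2 ∈ I}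
  let gvec : Matrix (Fin m) (Fin m) ℂ →ₗ[ℂ] (P → ℂ) :=
    { toFun := fun A q => A q.1.1 q.1.2, map_add' := fun _ _ => rfl, map_smul' := fun _ _ => rfl }
  let lvec : Matrix (Fin m) (Fin m) ℂ →ₗ[ℂ] (P → ℂ) :=
    { toFun := fun B q => B q.1.2 q.1.1, map_add' := fun _ _ => rfl, map_smul' := fun _ _ => rfl }
  -- orthogonality from trace isotropy
  have horth : ∀ A ∈ G, ∀ B ∈ L, gvec A ⬝ᵥ lvec B = 0 := by
    intro A hA B hB
    have ht := Literature.LinearAlgebra.Matrix.trace_mul_eq_zero_of_mem W hW (hG hA) (hL hB)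
    rw [trace_mul_eq_sum_glue I A B (hGsupp A hA)] at ht
    have hdot : gvec A ⬝ᵥ lvec B = ∑ q : P, A q.1.1 q.1.2 * B q.1.2 q.1.1 := rfl
    rw [hdot]
    exact ht
  -- injectivity of the coordinate maps on `G` and on `L`
  have hginj : Function.Injective (gvec ∘ₗ G.subtype) := by
    intro x y h
    have h' : gvec x.1 = gvec y.1 := h
    apply Subtype.ext
    ext i j
    show x.1 i j = y.1 i j
    by_cases hq : i ∉ I ∧ j ∈ I
    · exact congr_fun h' ⟨(i, j), hq⟩
    · have hij : i ∈ I ∨ j ∉ I := by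
        by_cases hi : i ∈ I
        · exact Or.inl hi
        · exact Or.inr fun hj => hq ⟨hi, hj⟩
      rw [hGsupp x.1 x.2 i j hij, hGsupp y.1 y.2 i j hij]
  have hlinj : Function.Injective (lvec ∘ₗ L.subtype) := by
    intro x y h
    have h' : lvec x.1 = lvec y.1 := h
    apply Subtype.ext
    ext i j
    show x.1 i j = y.1 i j
    by_cases hq : j ∉ I ∧ i ∈ I
    · exact congr_fun h' ⟨(j, i), hq⟩
    · have hij : i ∉ I ∨ j ∈ I := by
        by_cases hj : j ∈ I
        · exact Or.inr hj
        · exact Or.inl fun hi => hq ⟨hj, hi⟩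
      rw [hLsupp x.1 x.2 i j hij, hLsupp y.1 y.2 i j hij]
  have hGdim : Module.finrank ℂ (G.map gvec) = Module.finrank ℂ G := by
    rw [← LinearMap.finrank_range_of_inj hginj, LinearMap.range_comp, Submodule.range_subtype]
  have hLdim : Module.finrank ℂ (L.map lvec) = Module.finrank ℂ L := by
    rw [← LinearMap.finrank_range_of_inj hlinj, LinearMap.range_comp, Submodule.range_subtype]
  -- the lift coordinates annihilate the glue coordinates
  let Φ : Submodule ℂ (Module.Dual ℂ (P → ℂ)) := (L.map lvec).map (dotProductEquiv ℂ P).toLinearMap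
  have hΦ : Φ ≤ (G.map gvec).dualAnnihilator := by
    intro f hf
    obtain ⟨y, hy, rfl⟩ := Submodule.mem_map.mp hf
    obtain ⟨B, hB, rfl⟩ := Submodule.mem_map.mp hy
    rw [Submodule.mem_dualAnnihilator]
    intro w hw
    obtain ⟨A, hA, rfl⟩ := Submodule.mem_map.mp hw
    change lvec B ⬝ᵥ gvec A = 0
    rw [dotProduct_comm]
    exact horth A hA B hB
  have hΦdim : Module.finrank ℂ Φ = Module.finrank ℂ L := by
    rw [← hLdim]
    exact LinearEquiv.finrank_map_eq _ _
  have hsum := Subspace.finrank_add_finrank_dualAnnihilator_eq (G.map gvec)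
  have hcard : Module.finrank ℂ (P → ℂ) = I.card * (m - I.card) := by
    rw [Module.finrank_fintype_fun_eq_card]
    let e : P ≃ {j // j ∈ I} × {i // i ∉ I} :=
      { toFun := fun q => (⟨q.1.2, q.2.2⟩, ⟨q.1.1, q.2.1⟩)
        invFun := fun p => ⟨(p.2.1, p.1.1), p.2.2, p.1.2⟩
        left_inv := fun q => rfl
        right_inv := fun p => rfl }
    rw [Fintype.card_congr e, Fintype.card_prod, Fintype.card_coe, Fintype.card_subtype_compl,
      Fintype.card_fin, Fintype.card_coe]
  have hmono := Submodule.finrank_mono hΦ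
  omega


/-- **(4,7) calibration (R277 (d)).**  The far-corner pencil `NSeven` of ✓ p648631 (`¬ HeavyTopInst 4 7`) is NOT
weight-thin at budget: `WeightThin ⇒ FlagCheap` (✓ G″) and `¬ FlagCheap 4 7 NSeven`.  Hence the finite version of
C⁺ fails at (4,7) TOGETHER with `HeavyTopInst 4 7` — (4,7) is not a separating instance for P3, and the asymptotic
`UniformWeightLaw` (∃ C₀ n₀ …) survives exactly as R2 does. -/
theorem not_weightThin_NSeven : ¬ WeightThin 4 7 NSeven := fun h =>
  not_flagCheap_NSeven (flagCheap_of_weightThin NSeven isAffine_NSeven h)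

end Summit.ValiantsHypothesis.ValiantsHypothesis.Cruxes.DualUnipotentThreeHalves.KrylovSeed

end
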